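import Summits.ABC.StewartYu.PadicG3OfData
import Summits.ABC.StewartYu.GenThreeFrameSpecOdd
import HarnessLib

/-!
# Cell abc-stewartyu, crux `Y07Odd` (stmt-ABC-19658), line `gen3-slab-odd`: from the DATA OF `FrameOdd` to the Gen-3 datum — the pivot of minimal
# `p`-adic order, `3 ≤ p`, and the signed Kummer condition in the form the half-step separation uses

`Summits/ABC/StewartYu/PadicG3FrameData.lean` — cell `abc-stewartyu` (seat p2-g4, F-odd lead).  Theorems; no named fact.

* `exists_pivot` — for `b ≠ 0` there is `j₀` with `b j₀ ≠ 0` of minimal `p`-adic order among the non-zero coefficients;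
* `three_le_of_prime_ne_two`;
* `not_isSquare_prod_of_kummer` — FrameOdd's hypothesis `(∃ γ, ∏ α^κ = γ² ∨ ∏ α^κ = −γ²) → ∀ j, 2 ∣ κ j` gives, for every non-empty `T`,
  `¬IsSquare (∏_{j∈T} α_j) ∧ ¬IsSquare (−∏_{j∈T} α_j)` (the `hind` of `PadicG3HalfSeparation` / `TwistHalf`).

WHAT THIS IS NOT: no frame; no crux moves.

References: K. Yu, Acta Math. 211 (2013) §1 (normalisations); Yu. V. Nesterenko, LNM 1819 (2003) §5.
-/

noncomputable section

open Finset
open Literature.NumberTheory.Transcendental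

namespace Summit.ABC.StewartYu

namespace G3FrameData

variable {p : ℕ} [Fact p.Prime] {n : ℕ}

omit [Fact p.Prime] in
/-- **A pivot**: `b ≠ 0` has a non-zero coefficient of minimal `p`-adic order. [cite: Yu2013, §1; shape only] -/
theorem exists_pivot (b : Fin n → ℤ) (hb : b ≠ 0) :
    ∃ j₀ : Fin n, b j₀ ≠ 0 ∧ ∀ j, b j ≠ 0 → padicValInt p (b j₀) ≤ padicValInt p (b j) := by
  classical
  have hne : (univ.filter fun j => b j ≠ 0).Nonempty := by
    by_contra h0
    rw [Finset.not_nonempty_iff_eq_empty, Finset.filter_eq_empty_iff] at h0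
    apply hb
    funext j
    simpa using h0 (mem_univ j)
  obtain ⟨j₀, hj₀, hmin⟩ := Finset.exists_min_image _ (fun j => padicValInt p (b j)) hne
  refine ⟨j₀, (mem_filter.mp hj₀).2, fun j hj => hmin j (mem_filter.mpr ⟨mem_univ j, hj⟩)⟩

/-- An odd prime is at least `3`. [folklore] -/
theorem three_le_of_prime_ne_two (hp2 : p ≠ 2) : 3 ≤ p := by
  have hp : p.Prime := Fact.out
  have := hp.two_le
  omega

/-- **The signed Kummer condition for the separation.**  If every `κ` with `∏ α^κ = ±γ²` is even, then no product of a non-empty set of the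
generators is `±` a rational square. [cite: Nesterenko2003, §5 (Kummer hypothesis); shape only] -/
theorem not_isSquare_prod_of_kummer (α : Fin n → ℚ)
    (hK : ∀ κ : Fin n → ℤ, (∃ γ : ℚ, ∏ j, α j ^ κ j = γ ^ 2 ∨ ∏ j, α j ^ κ j = -γ ^ 2) → ∀ j, (2 : ℤ) ∣ κ j)
    (T : Finset (Fin n)) (hT : T.Nonempty) :
    ¬ IsSquare (∏ j ∈ T, α j) ∧ ¬ IsSquare (-∏ j ∈ T, α j) := by
  classical
  -- the indicator exponent of `T`
  set κ : Fin n → ℤ := fun j => if j ∈ T then 1 else 0 with hκ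
  have hprod : ∏ j, α j ^ κ j = ∏ j ∈ T, α j := by
    rw [← Finset.prod_filter_mul_prod_filter_not univ (fun j => j ∈ T)]
    have h1 : ∏ j ∈ univ.filter (fun j => j ∈ T), α j ^ κ j = ∏ j ∈ T, α j := by
      rw [show univ.filter (fun j => j ∈ T) = T by ext j; simp]
      exact prod_congr rfl fun j hj => by simp [hκ, hj]
    have h2 : ∏ j ∈ univ.filter (fun j => ¬ j ∈ T), α j ^ κ j = 1 :=
      prod_eq_one fun j hj => by simp [hκ, (mem_filter.mp hj).2]
    rw [h1, h2, mul_one]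
  obtain ⟨j₁, hj₁⟩ := hT
  have hodd : ¬ (2 : ℤ) ∣ κ j₁ := by simp [hκ, hj₁]
  constructor
  · rintro ⟨γ, hγ⟩
    exact hodd (hK κ ⟨γ, Or.inl (by rw [hprod, hγ, sq])⟩ j₁)
  · rintro ⟨γ, hγ⟩
    refine hodd (hK κ ⟨γ, Or.inr ?_⟩ j₁)
    rw [hprod, sq, ← hγ, neg_neg]

end G3FrameData

end Summit.ABC.StewartYu

end
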